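import Literature.AnabelianGeometry.SemiGraphs.OfProfiniteGroups
import Literature.AnabelianGeometry.SemiGraphs.CommensurabilityProofs
import Literature.AnabelianGeometry.Anabelioids.BCatFundamentalGroup

/-!
# [SemiAnbd] Remark 2.5.1, second assertion: the image of `Π_v = G^ℕ` in `Π_𝒢` is trivial

Mochizuki, *Semi-graphs of anabelioids*, Publ. RIMS **42** (2006), Remark 2.5.1 pp. 27–28
[cite: MochizukiSemiAnbd2006, Rem. 2.5.1 p.28].  For the loop graph of anabelioids `𝒢` with vertex
and edge anabelioid `B(G^ℕ)` (`G = ℤ/lℤ`) glued by the identity and the shift `B(α)`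
(`remark251Groups l`), we DISCHARGE the named fact `remark_2_5_1_trivialImage` of
`OfProfiniteGroups.lean`:

1. `remark251_ρ_apply_eq_one` — every vertex object `S` of an object of `B(𝒢)` carries the TRIVIAL
   `G^ℕ`-action: the two gluing isomorphisms give `α^* S ≅ S`, so the (open) kernel `K` of the action
   satisfies `α⁻¹(K) = K`, whence `K = G^ℕ` by the observation of Remark 2.5.1
   (`eq_top_of_isOpen_of_comap_shiftHom_eq`);
2. at the forgetful basepoint every element of `π₁(B(G^ℕ))` "is" an element `g ∈ G^ℕ`
   (`Anabelioids.exists_continuousMulEquiv_aut_forget`), so its image in `Π_𝒢` has components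
   `ρ_S(g) = 1`; an arbitrary basepoint is conjugate to the forgetful one (`pi1Map_conjAut`).

Proof-only file.
-/

noncomputable section

namespace Literature.AnabelianGeometry.SemiGraphs

open CategoryTheory CategoryTheory.Limits CategoryTheory.Functor CategoryTheory.PreGaloisCategory
open Literature.AlgebraicGeometry.Frobenioids (BCat)
open Literature.AnabelianGeometry.Anabelioids
open scoped FintypeCatDiscrete

/-! ### The forgetful basepoint of `B(K)` -/

section Forget

universe u

/-- The forgetful functor of `B(K)` is a fibre functor (the basepoint exhibited in the proof of
`Anabelioids.galoisCategory_bCat`; private copy). [cite: MochizukiGeoAn2004, §1.1 p.9] -/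
private theorem fiberFunctor_forget_bCat (K : Type u) [Group K] [TopologicalSpace K]
    [IsTopologicalGroup K] :
    letI := galoisCategory_bCat K
    FiberFunctor (ObjectProperty.ι (Action.IsContinuous (V := FintypeCat.{u}) (G := K)) ⋙
      Action.forget FintypeCat.{u} K) := by
  haveI hlim : ∀ (J : Type) [SmallCategory J] [FinCategory J],
      ObjectProperty.IsClosedUnderLimitsOfShape
        (Action.IsContinuous (V := FintypeCat.{u}) (G := K)) J :=
    fun J _ _ => isClosedUnderLimitsOfShape_isContinuous J
  haveI hcolim : ∀ (J : Type) [SmallCategory J] [FinCategory J],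
      ObjectProperty.IsClosedUnderColimitsOfShape
        (Action.IsContinuous (V := FintypeCat.{u}) (G := K)) J :=
    fun J _ _ => isClosedUnderColimitsOfShape_isContinuous J
  haveI : ∀ (J : Type) [SmallCategory J] [FinCategory J], HasLimitsOfShape J (BCat K) :=
    fun J _ _ => hasLimitsOfShape_of_closedUnderLimits J _
  haveI : ∀ (J : Type) [SmallCategory J] [FinCategory J], HasColimitsOfShape J (BCat K) :=
    fun J _ _ => hasColimitsOfShape_of_closedUnderColimits J _
  letI := galoisCategory_bCat K
  haveI : ∀ (J : Type) [SmallCategory J] [FinCategory J], PreservesLimitsOfShape J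
      (ObjectProperty.ι (Action.IsContinuous (V := FintypeCat.{u}) (G := K)) ⋙
        Action.forget FintypeCat.{u} K) :=
    fun J _ _ => inferInstance
  haveI : ∀ (J : Type) [SmallCategory J] [FinCategory J], PreservesColimitsOfShape J
      (ObjectProperty.ι (Action.IsContinuous (V := FintypeCat.{u}) (G := K)) ⋙
        Action.forget FintypeCat.{u} K) :=
    fun J _ _ => inferInstance
  exact
    { preservesTerminalObjects := inferInstance
      preservesPullbacks := inferInstance
      preservesFiniteCoproducts := ⟨fun _ => inferInstance⟩
      preservesEpis := inferInstance
      preservesQuotientsByFiniteGroups := fun H _ _ => by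
        obtain ⟨H', _, _, ⟨e⟩⟩ :
            ∃ (H' : Type) (_ : Group H') (_ : Fintype H'), Nonempty (H ≃* H') :=
          Finite.exists_type_univ_nonempty_mulEquiv H
        exact preservesColimitsOfShape_of_equiv e.toSingleObjEquiv.symm _
      reflectsIsos := ⟨fun f hf => by
        haveI : IsIso f.hom.hom := hf
        haveI : IsIso f.hom := inferInstance
        exact (ObjectProperty.isIso_hom_iff f).mp this⟩ }

end Forget

/-! ### Remark 2.5.1: triviality of the vertex actions and of the image of `Π_v` -/

section Remark251

variable (l : ℕ)

/-- **Every vertex object of `B(𝒢)` has trivial `G^ℕ`-action** (Remark 2.5.1): for an object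
`{S, T, ψ}` of `B(𝒢)`, the composite `ψ_{true}⁻¹ ∘ ψ_{false} : α^* S ⥲ S` shows that the kernel `K` of
the action on `S` — an open subgroup, `S` being a finite continuous `G^ℕ`-set — satisfies
`α⁻¹(K) = K`, so `K = G^ℕ` by the observation of Remark 2.5.1.
[cite: MochizukiSemiAnbd2006, Rem. 2.5.1 p.28] -/
theorem remark251_ρ_apply_eq_one (A : (remark251Groups l).toAnabelioids.BObj)
    (g : (remark251Groups l).GV PUnit.unit) : (A.S PUnit.unit).obj.ρ g = 1 := by
  classical
  let S := A.S PUnit.unit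
  let θ : ((remark251Groups l).toAnabelioids.pull false PUnit.unit rfl).pullback.obj S ≅
      ((remark251Groups l).toAnabelioids.pull true PUnit.unit rfl).pullback.obj S :=
    (A.ψ false PUnit.unit rfl) ≪≫ (A.ψ true PUnit.unit rfl).symm
  -- the shift, typed as an endomorphism of the vertex group, and `θ` as a bijection of `S`
  let α : (remark251Groups l).GV PUnit.unit →* (remark251Groups l).GV PUnit.unit :=
    shiftHom (Multiplicative (ZMod l))
  let θh : S.obj.V → S.obj.V := fun s => θ.hom.hom.hom s
  let θi : S.obj.V → S.obj.V := fun s => θ.inv.hom.hom s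
  -- `θ (α(x) • s) = x • θ s`
  have hpt : ∀ (x : (remark251Groups l).GV PUnit.unit) (s : S.obj.V), θh (α x • s) = x • θh s := by
    intro x s
    have h := ConcreteCategory.congr_hom (θ.hom.hom.comm x) s
    rw [FintypeCat.comp_apply, FintypeCat.comp_apply] at h
    exact h
  -- `θ` is a bijection
  have hli : ∀ s : S.obj.V, θi (θh s) = s := fun s => by
    have h := ConcreteCategory.congr_hom (congrArg (fun f => f.hom.hom) θ.hom_inv_id) s
    exact h
  have hri : ∀ s : S.obj.V, θh (θi s) = s := fun s => by
    have h := ConcreteCategory.congr_hom (congrArg (fun f => f.hom.hom) θ.inv_hom_id) s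
    exact h
  -- the kernel of the action
  let K : Subgroup ((remark251Groups l).GV PUnit.unit) :=
    (MulAction.toPermHom ((remark251Groups l).GV PUnit.unit) S.obj.V).ker
  have memK : ∀ x, x ∈ K ↔ ∀ s : S.obj.V, x • s = s := fun x => by
    simp only [K, MonoidHom.mem_ker, Equiv.ext_iff, MulAction.toPermHom_apply,
      MulAction.toPerm_apply, Equiv.Perm.coe_one, id_eq]
  have hK : IsOpen (K : Set ((remark251Groups l).GV PUnit.unit)) := by
    have hEq : (K : Set ((remark251Groups l).GV PUnit.unit)) =
        ⋂ s : S.obj.V, (MulAction.stabilizer ((remark251Groups l).GV PUnit.unit) s : Set _) := by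
      ext x
      simp only [SetLike.mem_coe, memK, Set.mem_iInter, MulAction.mem_stabilizer_iff]
    rw [hEq]
    exact isOpen_iInter_of_finite fun s => (Induction.isContinuous_iff S.obj).mp S.property s
  have hα : K.comap α = K := by
    ext x
    rw [Subgroup.mem_comap, memK, memK]
    constructor
    · intro h t
      rw [← hri t, ← hpt, h]
    · intro h s
      rw [← hli (α x • s), hpt, h, hli]
  have htop := eq_top_of_isOpen_of_comap_shiftHom_eq K hK hα
  have hg : ∀ s : S.obj.V, g • s = s := (memK g).mp (htop ▸ Subgroup.mem_top g)
  apply FintypeCat.hom_ext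
  intro s
  exact hg s

/-- NAMED FACT `remark_2_5_1_trivialImage` ([SemiAnbd] Remark 2.5.1, second assertion, as read by the
tree) — DISCHARGED: for every basepoint of `B(G^ℕ)` at the vertex, `Π_v → Π_𝒢` is trivial.  At the
forgetful basepoint an element of `Π_v` is "act by `g`" (`π₁(B(G^ℕ)) = G^ℕ`), whose image has
components `ρ_S(g) = 1` by `remark251_ρ_apply_eq_one`; other basepoints are conjugate.
[cite: MochizukiSemiAnbd2006, Rem. 2.5.1 p.28] -/
theorem remark_2_5_1_trivialImage_holds : remark_2_5_1_trivialImage := by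
  intro l _ F _ x
  haveI hforget : FiberFunctor
      (ObjectProperty.ι (Action.IsContinuous (V := FintypeCat.{0})
          (G := (remark251Groups l).GV PUnit.unit)) ⋙
        Action.forget FintypeCat.{0} ((remark251Groups l).GV PUnit.unit) :
        (remark251Groups l).toAnabelioids.V PUnit.unit ⥤ FintypeCat.{0}) :=
    fiberFunctor_forget_bCat ((remark251Groups l).GV PUnit.unit)
  obtain ⟨e⟩ := nonempty_iso_of_fiberFunctor
    (ObjectProperty.ι (Action.IsContinuous (V := FintypeCat.{0})
          (G := (remark251Groups l).GV PUnit.unit)) ⋙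
        Action.forget FintypeCat.{0} ((remark251Groups l).GV PUnit.unit) :
        (remark251Groups l).toAnabelioids.V PUnit.unit ⥤ FintypeCat.{0}) F
  obtain ⟨σ, rfl⟩ := e.conjAut.surjective x
  change pi1Map _ F (e.conjAut σ) = 1
  rw [pi1Map_conjAut]
  suffices h : pi1Map ((remark251Groups l).toAnabelioids.ρ PUnit.unit)
      (ObjectProperty.ι (Action.IsContinuous (V := FintypeCat.{0})
          (G := (remark251Groups l).GV PUnit.unit)) ⋙
        Action.forget FintypeCat.{0} ((remark251Groups l).GV PUnit.unit) :
        (remark251Groups l).toAnabelioids.V PUnit.unit ⥤ FintypeCat.{0}) σ = 1 by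
    rw [h, map_one]
  -- the dictionary `π₁(B(G^ℕ)) = G^ℕ`
  haveI : CompactSpace ((remark251Groups l).GV PUnit.unit) :=
    inferInstanceAs (CompactSpace (ℕ → Multiplicative (ZMod l)))
  haveI : T2Space ((remark251Groups l).GV PUnit.unit) :=
    inferInstanceAs (T2Space (ℕ → Multiplicative (ZMod l)))
  haveI : TotallyDisconnectedSpace ((remark251Groups l).GV PUnit.unit) :=
    inferInstanceAs (TotallyDisconnectedSpace (ℕ → Multiplicative (ZMod l)))
  obtain ⟨eG, heG⟩ := exists_continuousMulEquiv_aut_forget (G := (remark251Groups l).GV PUnit.unit)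
  obtain ⟨g, rfl⟩ := eG.surjective σ
  apply Iso.ext
  apply NatTrans.ext
  funext A
  rw [pi1Map_hom_app]
  erw [heG g (A.S PUnit.unit)]
  rw [remark251_ρ_apply_eq_one]
  rfl

end Remark251

end Literature.AnabelianGeometry.SemiGraphs

end
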